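import Literature.Probability.RandomPlanarGeometry.ObliqueRBMWedgeBoundary
import Literature.Probability.RandomPlanarGeometry.ObliqueRBMWedgeConformal
import HarnessLib

/-!
# The pulled-back test function `F = Re(Φₑ ∘ W_N)` and its derivative data

Layer of the proof of
`Literature.Probability.RandomPlanarGeometry.LawlerSchrammWerner2001_orbm_uniformHitting`
(`ObliqueRBMWedge.lean`). With the primitive `Φ` / its extension `Φₑ` (`ObliqueRBMWedgeBoundary`)
and the inverse uniformising map `W_N = wInv N` of the closed canonical triangle
(`ObliqueRBMWedgeConformal`), we define

* the half-plane derivative densities `E₁ = Φ'/(c Ψ'ₑ)` (first `z`-derivative pulled back) and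
  `E₂ = (iB²/c²)(w(1−w)g' + (1−2w)g/3)` (second `z`-derivative pulled back), where
  `c = N(ζ − 1)`, `B = B(1/3,1/3)`, `Ψ'ₑ = P²Q²/B`; the relation `E₁' = E₂ · cΨ'ₑ`
  (`hasDerivAt_E₁`), their decay at `∞`, continuity off the slit `[0,1]`, and the oblique
  boundary phases `Re(E₁ ζ) = 0` on `(−∞,0)`, `Re E₁ = 0` on `(1,∞)`;
* the `z`-plane objects `G = Φₑ ∘ W_N` (value `Φ(∞)` at the apex), `G₁ = E₁ ∘ W_N`,
  `G₂ = E₂ ∘ W_N` (value `0` at the apex), their continuity on the closed sub-triangles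
  `levelRegion M'`, `M' < N`, and on the closed triangle for `G`, and the complex derivatives
  `G' = G₁`, `G₁' = G₂` on the open triangle.

## References

* J. Dubédat, Ann. IHP 40 (2004), §4 (boundary conditions of the oblique RBM under conformal
  maps); L. V. Ahlfors, *Complex Analysis* (1979), Ch. 6 §2. [Dubedat2004]
-/

noncomputable section

open Set Filter Topology Complex Metric
open scoped Real
open UpperHalfPlane (upperHalfPlaneSet isOpen_upperHalfPlaneSet)

namespace Literature.Probability.RandomPlanarGeometry

/-! ### Algebra of the branches -/

/-- Auxiliary statement (`cbrtInvDown_ne_zero`). [folklore] -/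
theorem cbrtInvDown_ne_zero (w : ℂ) : cbrtInvDown w ≠ 0 := Complex.exp_ne_zero _

/-- Auxiliary statement (`cbrtInvOneSubDown_ne_zero`). [folklore] -/
theorem cbrtInvOneSubDown_ne_zero (w : ℂ) : cbrtInvOneSubDown w ≠ 0 := Complex.exp_ne_zero _

/-- `1/P = P² w`. [folklore] -/
theorem inv_cbrtInvDown {w : ℂ} (hw : w ≠ 0) : (cbrtInvDown w)⁻¹ = cbrtInvDown w ^ 2 * w := by
  have hP := cbrtInvDown_ne_zero w
  have h3 := cbrtInvDown_pow_three hw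
  have : cbrtInvDown w ^ 2 * w * cbrtInvDown w = 1 := by
    calc cbrtInvDown w ^ 2 * w * cbrtInvDown w = cbrtInvDown w ^ 3 * w := by ring
      _ = 1 := by rw [h3, inv_mul_cancel₀ hw]
  exact (eq_inv_of_mul_eq_one_left this).symm

/-- `1/Q = Q² (1 − w)`. [folklore] -/
theorem inv_cbrtInvOneSubDown {w : ℂ} (hw : w ≠ 1) : (cbrtInvOneSubDown w)⁻¹ = cbrtInvOneSubDown w ^ 2 * (1 - w) := by
  have hw1 : (1 - w) ≠ 0 := sub_ne_zero.2 (Ne.symm hw)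
  have h3 := cbrtInvOneSubDown_pow_three hw
  have : cbrtInvOneSubDown w ^ 2 * (1 - w) * cbrtInvOneSubDown w = 1 := by
    calc cbrtInvOneSubDown w ^ 2 * (1 - w) * cbrtInvOneSubDown w = cbrtInvOneSubDown w ^ 3 * (1 - w) := by ring
      _ = 1 := by rw [h3, inv_mul_cancel₀ hw1]
  exact (eq_inv_of_mul_eq_one_left this).symm

/-- On `ℍ`: `scDeriv w = P(w)² Q(w)²`. [folklore] -/
theorem scDeriv_eq_sq_mul_sq {w : ℂ} (hw : 0 < w.im) : scDeriv w = cbrtInvDown w ^ 2 * cbrtInvOneSubDown w ^ 2 := by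
  rw [scDeriv, cbrtInvDown_eq_cpow hw, cbrtInvOneSubDown_eq_cpow hw, ← cpow_nat_mul, ← cpow_nat_mul]
  congr 1 <;> · congr 1; push_cast; ring

/-! ### The pulled-back derivative densities on the half-plane -/

namespace TestIntervals

variable (D : TestIntervals) (N : ℝ)

/-- The derivative constant `c = N (ζ − 1)` of `σ_N`. [folklore] -/
def cN : ℂ := (N : ℂ) * (dirSixty - 1)

/-- Auxiliary statement (`cN_ne_zero`). [folklore] -/
theorem cN_ne_zero {N : ℝ} (hN : N ≠ 0) : cN N ≠ 0 :=
  mul_ne_zero (ofReal_ne_zero.2 hN) dirSixty_sub_one_ne_zero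

/-- The extended derivative `Ψ'ₑ = P² Q² / B` of `scPsi`. [folklore] -/
def psiDerivExt (w : ℂ) : ℂ := cbrtInvDown w ^ 2 * cbrtInvOneSubDown w ^ 2 / incBeta13 1

/-- On `ℍ`, `Ψ'ₑ = scDeriv / B` (the derivative of `scPsi`). [folklore] -/
theorem psiDerivExt_eq {w : ℂ} (hw : 0 < w.im) : psiDerivExt w = scDeriv w / incBeta13 1 := by
  rw [psiDerivExt, scDeriv_eq_sq_mul_sq hw]

/-- Auxiliary statement (`psiDerivExt_ne_zero`). [folklore] -/
theorem psiDerivExt_ne_zero (w : ℂ) : psiDerivExt w ≠ 0 :=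
  div_ne_zero (mul_ne_zero (pow_ne_zero _ (cbrtInvDown_ne_zero w)) (pow_ne_zero _ (cbrtInvOneSubDown_ne_zero w)))
    incBeta13_one_ne_zero_complex

/-- **First pulled-back derivative density** `E₁ = Φ'/(c Ψ'ₑ) = (iB/c) · g · P² Q² · w (1 − w)`.
[folklore] -/
def E₁ (w : ℂ) : ℂ :=
  I * (incBeta13 1 : ℂ) / cN N * D.g w * cbrtInvDown w ^ 2 * cbrtInvOneSubDown w ^ 2 * w * (1 - w)

/-- **Second pulled-back derivative density** `E₂ = (iB²/c²) (w(1−w) g' + (1 − 2w) g/3)`.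
[folklore] -/
def E₂ (w : ℂ) : ℂ :=
  I * (incBeta13 1 : ℂ) ^ 2 / cN N ^ 2 * (w * (1 - w) * D.g' w + (1 - 2 * w) * D.g w / 3)

/-- `E₁ = Φ' / (c Ψ'ₑ)` off `{0, 1}`. [folklore] -/
theorem E₁_eq_div {N : ℝ} (hN : N ≠ 0) {w : ℂ} (hw0 : w ≠ 0) (hw1 : w ≠ 1) :
    D.E₁ N w = D.phiKernel w / (cN N * psiDerivExt w) := by
  have hc := cN_ne_zero hN
  have hB := incBeta13_one_ne_zero_complex
  have hP := cbrtInvDown_ne_zero w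
  have hQ := cbrtInvOneSubDown_ne_zero w
  rw [E₁, phiKernel, psiDerivExt]
  have key : I * cbrtInvDown w * cbrtInvOneSubDown w * D.g w /
      (cN N * (cbrtInvDown w ^ 2 * cbrtInvOneSubDown w ^ 2 / (incBeta13 1 : ℂ)))
      = I * (incBeta13 1 : ℂ) / cN N * D.g w * (cbrtInvDown w)⁻¹ * (cbrtInvOneSubDown w)⁻¹ := by
    field_simp
  rw [key, inv_cbrtInvDown hw0, inv_cbrtInvOneSubDown hw1]; ring

/-- Auxiliary statement (`ne_zero_of_mem_kernelDomain`). [folklore] -/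
theorem ne_zero_of_mem_kernelDomain {w : ℂ} (hw : w ∈ D.kernelDomain) : w ≠ 0 := by
  rintro rfl; rcases hw.1.1 with h | h <;> simp at h

/-- Auxiliary statement (`ne_one_of_mem_kernelDomain`). [folklore] -/
theorem ne_one_of_mem_kernelDomain {w : ℂ} (hw : w ∈ D.kernelDomain) : w ≠ 1 := by
  rintro rfl; rcases hw.1.2 with h | h <;> simp at h

/-- **`E₁' = E₂ · c Ψ'ₑ`** on the holomorphy domain. [folklore] -/
theorem hasDerivAt_E₁ {N : ℝ} (hN : N ≠ 0) {w : ℂ} (hw : w ∈ D.kernelDomain) :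
    HasDerivAt (D.E₁ N) (D.E₂ N w * (cN N * psiDerivExt w)) w := by
  have hw0 := D.ne_zero_of_mem_kernelDomain hw
  have hw1 := D.ne_one_of_mem_kernelDomain hw
  have hw1' : (1 - w) ≠ 0 := sub_ne_zero.2 (Ne.symm hw1)
  have hc := cN_ne_zero hN
  have hB := incBeta13_one_ne_zero_complex
  have hP := hasDerivAt_cbrtInvDown hw.1.1
  have hQ := hasDerivAt_cbrtInvOneSubDown hw.1.2
  have hg := D.hasDerivAt_g hw.2
  have h := (((((hasDerivAt_const w (I * (incBeta13 1 : ℂ) / cN N)).mul hg).mul (hP.fun_pow 2)).mul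
    (hQ.fun_pow 2)).mul (hasDerivAt_id w)).mul ((hasDerivAt_const w (1:ℂ)).sub (hasDerivAt_id w))
  have h' : HasDerivAt (D.E₁ N) _ w := h.congr_of_eventuallyEq (Eventually.of_forall fun y ↦ by
    simp only [E₁, Pi.mul_apply, Pi.sub_apply, id_eq])
  refine h'.congr_deriv ?_
  simp only [Pi.mul_apply, Pi.sub_apply, id_eq, Nat.cast_ofNat, Nat.add_one_sub_one, pow_one]
  rw [E₂, psiDerivExt]
  field_simp
  ring

/-- Auxiliary statement (`continuousOn_E₁`). [folklore] -/
theorem continuousOn_E₁ (N : ℝ) : ContinuousOn (D.E₁ N) D.kernelDomain := by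
  intro w hw
  have hP : ContinuousAt cbrtInvDown w := continuousAt_cbrtInvDown hw.1.1
  have hQ : ContinuousAt cbrtInvOneSubDown w := continuousAt_cbrtInvOneSubDown hw.1.2
  have hg : ContinuousAt D.g w := (D.continuousOn_g w hw.2).continuousAt (D.isOpen_gDomain.mem_nhds hw.2)
  unfold E₁
  exact ((((((continuousAt_const.mul hg).mul (hP.pow 2)).mul (hQ.pow 2)).mul continuousAt_id).mul
    (continuousAt_const.sub continuousAt_id))).continuousWithinAt

/-- Auxiliary statement (`continuousOn_E₂`). [folklore] -/
theorem continuousOn_E₂ (N : ℝ) : ContinuousOn (D.E₂ N) D.gDomain := by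
  intro w hw
  have hg : ContinuousAt D.g w := (D.continuousOn_g w hw).continuousAt (D.isOpen_gDomain.mem_nhds hw)
  have hg' : ContinuousAt D.g' w := (D.continuousOn_g' w hw).continuousAt (D.isOpen_gDomain.mem_nhds hw)
  unfold E₂
  apply ContinuousAt.continuousWithinAt
  refine continuousAt_const.mul ?_
  exact ((continuousAt_id.mul (continuousAt_const.sub continuousAt_id)).mul hg').add
    (((continuousAt_const.sub (continuousAt_const.mul continuousAt_id)).mul hg).div_const _)

/-! ### Decay at infinity -/

/-- `‖P w‖² ‖w‖ = ‖w‖^{1/3}`. [folklore] -/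
theorem norm_cbrtInvDown_sq_mul {w : ℂ} (hw : w ≠ 0) : ‖cbrtInvDown w‖ ^ 2 * ‖w‖ = ‖w‖ ^ (1 / 3 : ℝ) := by
  have hpos : 0 < ‖w‖ := norm_pos_iff.2 hw
  rw [norm_cbrtInvDown hw, ← Real.rpow_natCast, ← Real.rpow_mul hpos.le]
  conv_lhs => rw [← Real.rpow_one ‖w‖, ← Real.rpow_mul hpos.le, ← Real.rpow_add hpos]
  norm_num

/-- `‖Q w‖² ‖1 − w‖ = ‖1 − w‖^{1/3}`. [folklore] -/
theorem norm_cbrtInvOneSubDown_sq_mul {w : ℂ} (hw : w ≠ 1) :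
    ‖cbrtInvOneSubDown w‖ ^ 2 * ‖1 - w‖ = ‖1 - w‖ ^ (1 / 3 : ℝ) := by
  have hpos : 0 < ‖1 - w‖ := norm_pos_iff.2 (sub_ne_zero.2 (Ne.symm hw))
  rw [norm_cbrtInvOneSubDown hw, ← Real.rpow_natCast, ← Real.rpow_mul hpos.le]
  conv_lhs => rw [← Real.rpow_one ‖1 - w‖, ← Real.rpow_mul hpos.le, ← Real.rpow_add hpos]
  norm_num

/-- `t^{1/3} ≤ t` for `t ≥ 1`. [folklore] -/
theorem rpow_third_le_self {t : ℝ} (ht : 1 ≤ t) : t ^ (1 / 3 : ℝ) ≤ t := by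
  conv_rhs => rw [← Real.rpow_one t]
  exact Real.rpow_le_rpow_of_exponent_le ht (by norm_num)

/-- `t^{1/3} ≤ t^{1/2} · ... `: we use the cruder `a^{1/3} b^{1/3} ≤ (ab)^{1/3}`-free bound
`‖w‖^{1/3} ‖1−w‖^{1/3} ≤ (2‖w‖²)^{1/3} ≤ 2 ‖w‖^{2/3}`; here is the product rule. [folklore] -/
theorem rpow_third_mul {a b : ℝ} (ha : 0 ≤ a) (hb : 0 ≤ b) : a ^ (1 / 3 : ℝ) * b ^ (1 / 3 : ℝ) = (a * b) ^ (1 / 3 : ℝ) :=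
  (Real.mul_rpow ha hb).symm

/-- **Decay of `E₁`**: `‖E₁(w)‖ ≤ (24 B/‖c‖) ‖w‖^{-4/3}` for `‖w‖ ≥ 4`. [folklore] -/
theorem norm_E₁_le {N : ℝ} (hN : N ≠ 0) {w : ℂ} (hw : 4 ≤ ‖w‖) :
    ‖D.E₁ N w‖ ≤ 24 * incBeta13 1 / ‖cN N‖ * ‖w‖ ^ (-(4 / 3 : ℝ)) := by
  have hw0 : w ≠ 0 := by rintro rfl; norm_num at hw
  have hw1 : w ≠ 1 := by rintro rfl; norm_num at hw
  have hwpos : 0 < ‖w‖ := by linarith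
  have hc : 0 < ‖cN N‖ := norm_pos_iff.2 (cN_ne_zero hN)
  have hB : 0 < incBeta13 1 := incBeta13_one_pos
  -- `‖E₁‖ = (B/‖c‖) ‖g‖ ‖w‖^{1/3} ‖1-w‖^{1/3}`
  have hnorm : ‖D.E₁ N w‖ = incBeta13 1 / ‖cN N‖ * ‖D.g w‖ * (‖w‖ ^ (1 / 3 : ℝ) * ‖1 - w‖ ^ (1 / 3 : ℝ)) := by
    rw [E₁]
    simp only [norm_mul, norm_div, Complex.norm_I, one_mul, Complex.norm_real, Real.norm_eq_abs, abs_of_pos hB,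
      norm_pow]
    rw [← norm_cbrtInvDown_sq_mul hw0, ← norm_cbrtInvOneSubDown_sq_mul hw1]
    ring
  rw [hnorm]
  have hg := D.norm_g_le hw
  have h1w : ‖1 - w‖ ≤ 2 * ‖w‖ := by
    calc ‖1 - w‖ ≤ ‖(1:ℂ)‖ + ‖w‖ := norm_sub_le _ _
      _ ≤ 2 * ‖w‖ := by rw [norm_one]; linarith
  have hprod : ‖w‖ ^ (1 / 3 : ℝ) * ‖1 - w‖ ^ (1 / 3 : ℝ) ≤ 2 * ‖w‖ ^ (2 / 3 : ℝ) := by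
    rw [rpow_third_mul (norm_nonneg _) (norm_nonneg _)]
    calc (‖w‖ * ‖1 - w‖) ^ (1 / 3 : ℝ) ≤ (‖w‖ * (2 * ‖w‖)) ^ (1 / 3 : ℝ) := by
          apply Real.rpow_le_rpow (by positivity) _ (by norm_num)
          exact mul_le_mul_of_nonneg_left h1w (norm_nonneg _)
      _ = 2 ^ (1 / 3 : ℝ) * ‖w‖ ^ (2 / 3 : ℝ) := by
          rw [show ‖w‖ * (2 * ‖w‖) = 2 * ‖w‖ ^ 2 by ring, Real.mul_rpow (by norm_num) (by positivity),
            ← Real.rpow_natCast, ← Real.rpow_mul (norm_nonneg _)]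
          norm_num
      _ ≤ 2 * ‖w‖ ^ (2 / 3 : ℝ) := by
          gcongr
          conv_rhs => rw [← Real.rpow_one 2]
          exact Real.rpow_le_rpow_of_exponent_le (by norm_num) (by norm_num)
  have hK : 0 ≤ incBeta13 1 / ‖cN N‖ := by positivity
  calc incBeta13 1 / ‖cN N‖ * ‖D.g w‖ * (‖w‖ ^ (1 / 3 : ℝ) * ‖1 - w‖ ^ (1 / 3 : ℝ))
      ≤ incBeta13 1 / ‖cN N‖ * (12 / ‖w‖ ^ 2) * (2 * ‖w‖ ^ (2 / 3 : ℝ)) := by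
        gcongr
    _ = 24 * incBeta13 1 / ‖cN N‖ * (‖w‖ ^ (2 / 3 : ℝ) / ‖w‖ ^ 2) := by ring
    _ = 24 * incBeta13 1 / ‖cN N‖ * ‖w‖ ^ (-(4 / 3 : ℝ)) := by
        congr 1
        rw [← Real.rpow_natCast ‖w‖ 2, ← Real.rpow_sub hwpos]
        norm_num

/-- **Decay of `E₂`**: `‖E₂(w)‖ ≤ (108 B²/‖c‖²) / ‖w‖` for `‖w‖ ≥ 4`. [folklore] -/
theorem norm_E₂_le {N : ℝ} (hN : N ≠ 0) {w : ℂ} (hw : 4 ≤ ‖w‖) :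
    ‖D.E₂ N w‖ ≤ 108 * incBeta13 1 ^ 2 / ‖cN N‖ ^ 2 / ‖w‖ := by
  have hwpos : 0 < ‖w‖ := by linarith
  have hc : 0 < ‖cN N‖ := norm_pos_iff.2 (cN_ne_zero hN)
  have hB : 0 < incBeta13 1 := incBeta13_one_pos
  have hg := D.norm_g_le hw
  have hg' := D.norm_g'_le (by linarith : 2 ≤ ‖w‖)
  have h1w : ‖1 - w‖ ≤ 2 * ‖w‖ := by
    calc ‖1 - w‖ ≤ ‖(1:ℂ)‖ + ‖w‖ := norm_sub_le _ _
      _ ≤ 2 * ‖w‖ := by rw [norm_one]; linarith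
  have h12w : ‖1 - 2 * w‖ ≤ 3 * ‖w‖ := by
    calc ‖1 - 2 * w‖ ≤ ‖(1:ℂ)‖ + ‖2 * w‖ := norm_sub_le _ _
      _ ≤ 3 * ‖w‖ := by rw [norm_one, norm_mul, Complex.norm_two]; linarith
  rw [E₂, norm_mul]
  have hK : ‖I * (incBeta13 1 : ℂ) ^ 2 / cN N ^ 2‖ = incBeta13 1 ^ 2 / ‖cN N‖ ^ 2 := by
    simp [norm_pow, Complex.norm_real, abs_of_pos hB]
  rw [hK]
  have hinner : ‖w * (1 - w) * D.g' w + (1 - 2 * w) * D.g w / 3‖ ≤ 108 / ‖w‖ := by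
    calc ‖w * (1 - w) * D.g' w + (1 - 2 * w) * D.g w / 3‖
        ≤ ‖w * (1 - w) * D.g' w‖ + ‖(1 - 2 * w) * D.g w / 3‖ := norm_add_le _ _
      _ = ‖w‖ * ‖1 - w‖ * ‖D.g' w‖ + ‖1 - 2 * w‖ * ‖D.g w‖ / 3 := by
          rw [norm_mul, norm_mul, norm_div, norm_mul, Complex.norm_ofNat]
      _ ≤ ‖w‖ * (2 * ‖w‖) * (48 / ‖w‖ ^ 3) + 3 * ‖w‖ * (12 / ‖w‖ ^ 2) / 3 := by
          gcongr
      _ = 108 / ‖w‖ := by field_simp; ring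
  calc incBeta13 1 ^ 2 / ‖cN N‖ ^ 2 * ‖w * (1 - w) * D.g' w + (1 - 2 * w) * D.g w / 3‖
      ≤ incBeta13 1 ^ 2 / ‖cN N‖ ^ 2 * (108 / ‖w‖) := by gcongr
    _ = 108 * incBeta13 1 ^ 2 / ‖cN N‖ ^ 2 / ‖w‖ := by ring

/-- `E₁ → 0` at infinity (eventual form). [folklore] -/
theorem exists_norm_E₁_lt {N : ℝ} (hN : N ≠ 0) {ε : ℝ} (hε : 0 < ε) :
    ∃ R, ∀ w : ℂ, R ≤ ‖w‖ → ‖D.E₁ N w‖ < ε := by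
  set K : ℝ := 24 * incBeta13 1 / ‖cN N‖ with hK
  have hc : 0 < ‖cN N‖ := norm_pos_iff.2 (cN_ne_zero hN)
  have hKpos : 0 < K := by rw [hK]; exact div_pos (mul_pos (by norm_num) incBeta13_one_pos) hc
  -- choose `R ≥ 4` with `K R^{-4/3} < ε`; since `R^{-4/3} ≤ R^{-1}` for `R ≥ 1`, take `R = max 4 (2K/ε)`
  refine ⟨max 4 (2 * K / ε), fun w hw ↦ ?_⟩
  have hw4 : 4 ≤ ‖w‖ := (le_max_left _ _).trans hw
  have hwpos : 0 < ‖w‖ := by linarith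
  have h1 := D.norm_E₁_le hN hw4
  have h2 : ‖w‖ ^ (-(4 / 3 : ℝ)) ≤ ‖w‖ ^ (-(1:ℝ)) :=
    Real.rpow_le_rpow_of_exponent_le (by linarith) (by norm_num)
  rw [Real.rpow_neg_one] at h2
  have h3 : K * ‖w‖⁻¹ < ε := by
    rw [← div_eq_mul_inv, div_lt_iff₀ hwpos]
    have := (le_max_right _ _).trans hw
    rw [div_le_iff₀ hε] at this
    linarith
  calc ‖D.E₁ N w‖ ≤ K * ‖w‖ ^ (-(4 / 3 : ℝ)) := h1
    _ ≤ K * ‖w‖⁻¹ := by gcongr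
    _ < ε := h3

/-- `E₂ → 0` at infinity (eventual form). [folklore] -/
theorem exists_norm_E₂_lt {N : ℝ} (hN : N ≠ 0) {ε : ℝ} (hε : 0 < ε) :
    ∃ R, ∀ w : ℂ, R ≤ ‖w‖ → ‖D.E₂ N w‖ < ε := by
  set K : ℝ := 108 * incBeta13 1 ^ 2 / ‖cN N‖ ^ 2 with hK
  have hc : 0 < ‖cN N‖ := norm_pos_iff.2 (cN_ne_zero hN)
  have hKpos : 0 < K := by rw [hK]; have := incBeta13_one_pos; positivity
  refine ⟨max 4 (2 * K / ε), fun w hw ↦ ?_⟩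
  have hw4 : 4 ≤ ‖w‖ := (le_max_left _ _).trans hw
  have hwpos : 0 < ‖w‖ := by linarith
  have h1 := D.norm_E₂_le hN hw4
  have h3 : K / ‖w‖ < ε := by
    rw [div_lt_iff₀ hwpos]
    have := (le_max_right _ _).trans hw
    rw [div_le_iff₀ hε] at this
    linarith
  exact h1.trans_lt h3

/-! ### Boundary phases: the oblique boundary conditions -/

/-- The primitive twelfth root `η = e^{iπ/6}`. [folklore] -/
def eta : ℂ := exp ((π / 6 : ℝ) * I)

/-- Auxiliary statement (`eta_ne_zero`). [folklore] -/
theorem eta_ne_zero : eta ≠ 0 := Complex.exp_ne_zero _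

/-- Auxiliary statement (`eta_pow_three`). [folklore] -/
theorem eta_pow_three : eta ^ 3 = I := by
  rw [eta, ← Complex.exp_nat_mul, show ((3:ℕ) : ℂ) * ((π / 6 : ℝ) * I) = π / 2 * I by push_cast; ring]
  exact exp_pi_div_two_mul_I

/-- Auxiliary statement (`eta_sq`). [folklore] -/
theorem eta_sq : eta ^ 2 = dirSixty := by
  rw [eta, dirSixty, ← Complex.exp_nat_mul]; congr 1; push_cast; ring

/-- Auxiliary statement (`exp_neg_pi_div_three`). [folklore] -/
theorem exp_neg_pi_div_three : exp (-(π / 3 : ℝ) * I) = (eta ^ 2)⁻¹ := by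
  rw [eta_sq, dirSixty, ← Complex.exp_neg]; congr 1; push_cast; ring

/-- Auxiliary statement (`exp_pi_div_three`). [folklore] -/
theorem exp_pi_div_three : exp ((π / 3 : ℝ) * I) = eta ^ 2 := by rw [eta_sq, dirSixty]

/-- Auxiliary statement (`exp_five_pi_div_six`). [folklore] -/
theorem exp_five_pi_div_six : exp ((5 * π / 6 : ℝ) * I) = eta ^ 5 := by
  rw [eta, ← Complex.exp_nat_mul]; congr 1; push_cast; ring

/-- `c = N (ζ − 1) = N ζ² = N η⁴`. [folklore] -/
theorem cN_eq (N : ℝ) : cN N = (N : ℂ) * eta ^ 4 := by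
  rw [cN, show eta ^ 4 = (eta ^ 2) ^ 2 by ring, eta_sq, dirSixty_eq_equilateralApex, equilateralApex_sq]

/-- **Oblique condition on the side `(−∞, 0)`**: `Re(E₁(v) ζ) = 0`. [folklore] -/
theorem re_E₁_mul_dirSixty_of_neg {N : ℝ} (hN : N ≠ 0) {v : ℝ} (hv : v < 0) :
    (D.E₁ N v * dirSixty).re = 0 := by
  have hv0 : (v : ℂ) ≠ 0 := by exact_mod_cast hv.ne
  have hv1 : (v : ℂ) ≠ 1 := by
    intro h; have := congrArg Complex.re h; simp at this; linarith
  rw [D.E₁_eq_div hN hv0 hv1, D.phiKernel_ofReal_neg hv, psiDerivExt, cbrtInvDown_ofReal_neg hv,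
    cbrtInvOneSubDown_ofReal_lt_one (by linarith), cN_eq, ← eta_sq, exp_neg_pi_div_three]
  rw [show exp ((π / 6 : ℝ) * I) = eta from rfl]
  set r₁ : ℝ := (-v) ^ (-(1 / 3 : ℝ)) * (1 - v) ^ (-(1 / 3 : ℝ)) * D.gRe v
  set r₂ : ℝ := (-v) ^ (-(1 / 3 : ℝ))
  set r₃ : ℝ := (1 - v) ^ (-(1 / 3 : ℝ))
  have hη := eta_ne_zero
  have key : eta * (r₁ : ℂ) / ((N : ℂ) * eta ^ 4 * (((r₂ : ℂ) * (eta ^ 2)⁻¹) ^ 2 * (r₃ : ℂ) ^ 2 / (incBeta13 1 : ℂ))) * eta ^ 2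
      = ((r₁ * incBeta13 1 / (N * r₂ ^ 2 * r₃ ^ 2) : ℝ) : ℂ) * eta ^ 3 := by
    push_cast
    field_simp
  rw [key, eta_pow_three]
  simp only [mul_I_re, ofReal_im, neg_zero]

/-- **Oblique condition on the side `(1, ∞)`**: `Re E₁(v) = 0`. [folklore] -/
theorem re_E₁_of_one_lt {N : ℝ} (hN : N ≠ 0) {v : ℝ} (hv : 1 < v) : (D.E₁ N v).re = 0 := by
  have hv0 : (v : ℂ) ≠ 0 := by exact_mod_cast (by linarith : v ≠ 0)
  have hv1 : (v : ℂ) ≠ 1 := by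
    intro h; have := congrArg Complex.re h; simp at this; linarith
  rw [D.E₁_eq_div hN hv0 hv1, D.phiKernel_ofReal_one_lt hv, psiDerivExt, cbrtInvDown_ofReal_pos (by linarith),
    cbrtInvOneSubDown_ofReal_one_lt hv, cN_eq, exp_five_pi_div_six, exp_pi_div_three]
  set r₁ : ℝ := v ^ (-(1 / 3 : ℝ)) * (v - 1) ^ (-(1 / 3 : ℝ)) * D.gRe v
  set r₂ : ℝ := v ^ (-(1 / 3 : ℝ))
  set r₃ : ℝ := (v - 1) ^ (-(1 / 3 : ℝ))
  have hη := eta_ne_zero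
  have key : eta ^ 5 * (r₁ : ℂ) / ((N : ℂ) * eta ^ 4 * ((r₂ : ℂ) ^ 2 * ((r₃ : ℂ) * eta ^ 2) ^ 2 / (incBeta13 1 : ℂ)))
      = ((r₁ * incBeta13 1 / (N * r₂ ^ 2 * r₃ ^ 2) : ℝ) : ℂ) * (eta ^ 3)⁻¹ := by
    push_cast
    field_simp
  rw [key, eta_pow_three, Complex.inv_I]
  simp only [mul_neg, neg_re, mul_I_re, ofReal_im, neg_zero]

/-! ### The pulled-back objects on the closed triangle -/

open scoped Classical in
/-- **`G = Φₑ ∘ W_N`** on the punctured closed triangle, with the value `Φ(∞)` at the apex.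
[folklore] -/
def Gfun (N : ℝ) (z : ℂ) : ℂ := if z = 0 then D.phiInf else D.phiExt (wInv N z)

open scoped Classical in
/-- **`G₁ = E₁ ∘ W_N`** (the complex derivative of `G`), value `0` at the apex. [folklore] -/
def G₁fun (N : ℝ) (z : ℂ) : ℂ := if z = 0 then 0 else D.E₁ N (wInv N z)

open scoped Classical in
/-- **`G₂ = E₂ ∘ W_N`** (the second complex derivative of `G`), value `0` at the apex. [folklore] -/
def G₂fun (N : ℝ) (z : ℂ) : ℂ := if z = 0 then 0 else D.E₂ N (wInv N z)

/-- Auxiliary statement (`Gfun_zero`). [folklore] -/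
@[simp] theorem Gfun_zero (N : ℝ) : D.Gfun N 0 = D.phiInf := by simp [Gfun]

/-- Auxiliary statement (`G₁fun_zero`). [folklore] -/
@[simp] theorem G₁fun_zero (N : ℝ) : D.G₁fun N 0 = 0 := by simp [G₁fun]

/-- Auxiliary statement (`G₂fun_zero`). [folklore] -/
@[simp] theorem G₂fun_zero (N : ℝ) : D.G₂fun N 0 = 0 := by simp [G₂fun]

/-- Auxiliary statement (`Gfun_of_ne`). [folklore] -/
theorem Gfun_of_ne (N : ℝ) {z : ℂ} (hz : z ≠ 0) : D.Gfun N z = D.phiExt (wInv N z) := by simp [Gfun, hz]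

/-- Auxiliary statement (`G₁fun_of_ne`). [folklore] -/
theorem G₁fun_of_ne (N : ℝ) {z : ℂ} (hz : z ≠ 0) : D.G₁fun N z = D.E₁ N (wInv N z) := by simp [G₁fun, hz]

/-- Auxiliary statement (`G₂fun_of_ne`). [folklore] -/
theorem G₂fun_of_ne (N : ℝ) {z : ℂ} (hz : z ≠ 0) : D.G₂fun N z = D.E₂ N (wInv N z) := by simp [G₂fun, hz]

/-- The image of a point of `levelRegion M' ∖ {0}`, `M' < N`, under `W_N` lies in the holomorphy
domain of the kernel (off the slit `[0,1]` and the downward rays). [folklore] -/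
theorem wInv_mem_kernelDomain {N M' : ℝ} (hN : 0 < N) (hM' : M' < N) {z : ℂ} (hz : z ∈ levelRegion M') (hz0 : z ≠ 0) :
    wInv N z ∈ D.kernelDomain := by
  have hzp : z ∈ puncturedRegion N := levelRegion_diff_subset hM'.le ⟨hz, hz0⟩
  have hl : quadX z + quadY z < N := lt_of_le_of_lt hz.2.2 hM'
  rcases wInv_not_mem_unitInterval hN hzp hl with him | ⟨him, hre | hre⟩
  · exact D.upperHalfPlaneSet_subset_kernelDomain him
  · have heq : wInv N z = (((wInv N z).re : ℝ) : ℂ) := Complex.ext (by simp) (by simp [him])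
    rw [heq]; exact D.ofReal_mem_kernelDomain_of_neg hre
  · have heq : wInv N z = (((wInv N z).re : ℝ) : ℂ) := Complex.ext (by simp) (by simp [him])
    rw [heq]; exact D.ofReal_mem_kernelDomain_of_one_lt hre

/-- Auxiliary statement (`puncturedRegion_mem_nhdsWithin`). [folklore] -/
theorem diff_singleton_mem_nhdsWithin {s : Set ℂ} {z : ℂ} (hz : z ≠ 0) : s \ {0} ∈ 𝓝[s] z := by
  have : ({0}ᶜ : Set ℂ) ∈ 𝓝 z := isOpen_compl_singleton.mem_nhds hz
  exact Filter.inter_mem self_mem_nhdsWithin (mem_nhdsWithin_of_mem_nhds this)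

/-- **Continuity of `G` away from the apex** (on the closed triangle). [folklore] -/
theorem continuousWithinAt_Gfun_of_ne {N : ℝ} (hN : 0 < N) {z : ℂ} (hz : z ∈ levelRegion N) (hz0 : z ≠ 0) :
    ContinuousWithinAt (D.Gfun N) (levelRegion N) z := by
  have hzp : z ∈ puncturedRegion N := ⟨hz, hz0⟩
  have h1 : ContinuousWithinAt (fun y ↦ D.phiExt (wInv N y)) (puncturedRegion N) z :=
    (D.continuousOn_phiExt (wInv N z) (wInv_im_nonneg hN hzp)).comp (continuousWithinAt_wInv hN hzp)
      fun y hy ↦ wInv_im_nonneg hN hy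
  have h2 : ContinuousWithinAt (D.Gfun N) (puncturedRegion N) z :=
    h1.congr (fun y hy ↦ D.Gfun_of_ne N hy.2) (D.Gfun_of_ne N hz0)
  exact h2.mono_of_mem_nhdsWithin (diff_singleton_mem_nhdsWithin hz0)

/-- **Continuity of `G` at the apex**: `Φₑ(W_N z) → Φ(∞)` as `z → 0`. [folklore] -/
theorem continuousWithinAt_Gfun_zero {N : ℝ} (hN : 0 < N) : ContinuousWithinAt (D.Gfun N) (levelRegion N) 0 := by
  rw [← continuousWithinAt_sdiff_self]
  change Tendsto (D.Gfun N) (𝓝[puncturedRegion N] 0) (𝓝 (D.Gfun N 0))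
  rw [Gfun_zero, Metric.tendsto_nhds]
  intro ε hε
  have hev := eventually_lt_norm_wInv hN (max 4 (33 / ε))
  filter_upwards [hev, self_mem_nhdsWithin] with z hz hzp
  rw [D.Gfun_of_ne N hzp.2, dist_eq_norm]
  have h4 : 4 < ‖wInv N z‖ := lt_of_le_of_lt (le_max_left _ _) hz
  have hb := D.norm_phiExt_sub_phiInf_le (wInv_im_nonneg hN hzp) h4
  have hpos : 0 < ‖wInv N z‖ := by linarith
  have : 33 / ‖wInv N z‖ < ε := by
    rw [div_lt_iff₀ hpos]
    have := lt_of_le_of_lt (le_max_right _ _) hz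
    rw [div_lt_iff₀ hε] at this
    linarith
  linarith

/-- Auxiliary statement (`continuousOn_Gfun`). [folklore] -/
theorem continuousOn_Gfun {N : ℝ} (hN : 0 < N) : ContinuousOn (D.Gfun N) (levelRegion N) := by
  intro z hz
  by_cases hz0 : z = 0
  · subst hz0; exact D.continuousWithinAt_Gfun_zero hN
  · exact D.continuousWithinAt_Gfun_of_ne hN hz hz0

/-- **Continuity of `G₁` on the closed sub-triangles `levelRegion M'`, `M' < N`.** [folklore] -/
theorem continuousOn_G₁fun {N M' : ℝ} (hN : 0 < N) (hM' : M' < N) : ContinuousOn (D.G₁fun N) (levelRegion M') := by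
  intro z hz
  by_cases hz0 : z = 0
  · subst hz0
    rw [← continuousWithinAt_sdiff_self]
    change Tendsto (D.G₁fun N) (𝓝[levelRegion M' \ {0}] 0) (𝓝 (D.G₁fun N 0))
    rw [G₁fun_zero, Metric.tendsto_nhds]
    intro ε hε
    obtain ⟨R, hR⟩ := D.exists_norm_E₁_lt hN.ne' hε
    have hev := eventually_lt_norm_wInv hN R
    have hle : 𝓝[levelRegion M' \ {0}] (0:ℂ) ≤ 𝓝[puncturedRegion N] 0 :=
      nhdsWithin_mono _ (levelRegion_diff_subset hM'.le)
    filter_upwards [hle hev, self_mem_nhdsWithin] with z hz hzp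
    rw [D.G₁fun_of_ne N hzp.2, dist_zero_right]
    exact hR _ hz.le
  · have hzp : z ∈ puncturedRegion N := levelRegion_diff_subset hM'.le ⟨hz, hz0⟩
    have hdom := D.wInv_mem_kernelDomain hN hM' hz hz0
    have hE : ContinuousAt (D.E₁ N) (wInv N z) :=
      (D.continuousOn_E₁ N _ hdom).continuousAt (D.isOpen_kernelDomain.mem_nhds hdom)
    have h1 : ContinuousWithinAt (fun y ↦ D.E₁ N (wInv N y)) (puncturedRegion N) z :=
      hE.comp_continuousWithinAt (continuousWithinAt_wInv hN hzp)
    have h2 : ContinuousWithinAt (D.G₁fun N) (puncturedRegion N) z :=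
      h1.congr (fun y hy ↦ D.G₁fun_of_ne N hy.2) (D.G₁fun_of_ne N hz0)
    exact (h2.mono (levelRegion_diff_subset hM'.le)).mono_of_mem_nhdsWithin (diff_singleton_mem_nhdsWithin hz0)

/-- **Continuity of `G₂` on the closed sub-triangles `levelRegion M'`, `M' < N`.** [folklore] -/
theorem continuousOn_G₂fun {N M' : ℝ} (hN : 0 < N) (hM' : M' < N) : ContinuousOn (D.G₂fun N) (levelRegion M') := by
  intro z hz
  by_cases hz0 : z = 0
  · subst hz0
    rw [← continuousWithinAt_sdiff_self]
    change Tendsto (D.G₂fun N) (𝓝[levelRegion M' \ {0}] 0) (𝓝 (D.G₂fun N 0))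
    rw [G₂fun_zero, Metric.tendsto_nhds]
    intro ε hε
    obtain ⟨R, hR⟩ := D.exists_norm_E₂_lt hN.ne' hε
    have hev := eventually_lt_norm_wInv hN R
    have hle : 𝓝[levelRegion M' \ {0}] (0:ℂ) ≤ 𝓝[puncturedRegion N] 0 :=
      nhdsWithin_mono _ (levelRegion_diff_subset hM'.le)
    filter_upwards [hle hev, self_mem_nhdsWithin] with z hz hzp
    rw [D.G₂fun_of_ne N hzp.2, dist_zero_right]
    exact hR _ hz.le
  · have hzp : z ∈ puncturedRegion N := levelRegion_diff_subset hM'.le ⟨hz, hz0⟩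
    have hdom := (D.wInv_mem_kernelDomain hN hM' hz hz0).2
    have hE : ContinuousAt (D.E₂ N) (wInv N z) :=
      (D.continuousOn_E₂ N _ hdom).continuousAt (D.isOpen_gDomain.mem_nhds hdom)
    have h1 : ContinuousWithinAt (fun y ↦ D.E₂ N (wInv N y)) (puncturedRegion N) z :=
      hE.comp_continuousWithinAt (continuousWithinAt_wInv hN hzp)
    have h2 : ContinuousWithinAt (D.G₂fun N) (puncturedRegion N) z :=
      h1.congr (fun y hy ↦ D.G₂fun_of_ne N hy.2) (D.G₂fun_of_ne N hz0)
    exact (h2.mono (levelRegion_diff_subset hM'.le)).mono_of_mem_nhdsWithin (diff_singleton_mem_nhdsWithin hz0)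

/-! ### Complex derivatives on the open triangle -/

/-- **`G' = G₁` on the open triangle.** [folklore] -/
theorem hasDerivAt_Gfun {N : ℝ} (hN : 0 < N) {z : ℂ} (hz : z ∈ openTri N) :
    HasDerivAt (D.Gfun N) (D.G₁fun N z) z := by
  have hz0 : z ≠ 0 := (openTri_subset_puncturedRegion N hz).2
  have him := wInv_im_pos hN hz
  have hW := hasDerivAt_wInv hN hz
  have hΦ := D.hasDerivAt_phi him
  have hcomp := hΦ.comp z hW
  -- `G = Φ ∘ W` near `z`
  have heq : D.Gfun N =ᶠ[𝓝 z] fun y ↦ D.phi (wInv N y) := by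
    filter_upwards [(isOpen_openTri N).mem_nhds hz] with y hy
    rw [D.Gfun_of_ne N (openTri_subset_puncturedRegion N hy).2, D.phiExt_eq (wInv_im_pos hN hy)]
  refine (hcomp.congr_of_eventuallyEq heq).congr_deriv ?_
  -- the value: `Φ'(w) (c Ψ'(w))⁻¹ = E₁ w`
  have hw0 : wInv N z ≠ 0 := by intro h; rw [h] at him; simp at him
  have hw1 : wInv N z ≠ 1 := by intro h; rw [h] at him; simp at him
  rw [D.G₁fun_of_ne N hz0, D.E₁_eq_div hN.ne' hw0 hw1, psiDerivExt_eq him, cN, div_eq_mul_inv, div_eq_mul_inv]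

/-- **`G₁' = G₂` on the open triangle.** [folklore] -/
theorem hasDerivAt_G₁fun {N : ℝ} (hN : 0 < N) {z : ℂ} (hz : z ∈ openTri N) :
    HasDerivAt (D.G₁fun N) (D.G₂fun N z) z := by
  have hz0 : z ≠ 0 := (openTri_subset_puncturedRegion N hz).2
  have him := wInv_im_pos hN hz
  have hW := hasDerivAt_wInv hN hz
  have hE := D.hasDerivAt_E₁ hN.ne' (D.upperHalfPlaneSet_subset_kernelDomain him)
  have hcomp := hE.comp z hW
  have heq : D.G₁fun N =ᶠ[𝓝 z] fun y ↦ D.E₁ N (wInv N y) := by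
    filter_upwards [(isOpen_openTri N).mem_nhds hz] with y hy
    rw [D.G₁fun_of_ne N (openTri_subset_puncturedRegion N hy).2]
  refine (hcomp.congr_of_eventuallyEq heq).congr_deriv ?_
  rw [D.G₂fun_of_ne N hz0, psiDerivExt_eq him, cN, mul_assoc,
    mul_inv_cancel₀ (PsiC_deriv_ne_zero hN.ne' him), mul_one]

end TestIntervals

end Literature.Probability.RandomPlanarGeometry
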